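import Literature.NumberTheory.Sieve.FriedlanderIwaniecPrimesJacobiTwistedProp131
import Literature.NumberTheory.Sieve.FriedlanderIwaniecPrimesJacobiTwistedConclusion
import HarnessLib

/-!
# Friedlander–Iwaniec, *The polynomial `X² + Y⁴` captures its primes*, §14: Proposition 14.1 from Proposition 12.1 alone

[FI, §14, p. 53 of arXiv:math/9811185], Proposition 14.1:
`Σ_{D<d≤2D} Σ_{a (mod d)} |Σ_{r̄s ≡ a (mod d)} α_{rs} (r/d)|² ≤ 𝒩(D, R, S) Σ_r Σ_s τ(r)|α_{rs}|²`,
`𝒩(D, R, S) ≪ D + D^{-1/2}RS + D^{1/3}(RS)^{2/3}(log 2RS)⁴ + (R+S)^{1/12}(RS)^{11/12+ε}`,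
"by application of Proposition 11.1 if `D ≤ D₁`, Proposition 13.1 if `D₁ < D < D₂`, and Proposition
12.1 if `D ≥ D₂`".

The tree holds this deduction with Propositions 12.1 and 13.1 as hypotheses at the level `D`
(`jtV_le_of_three_ranges`, Proposition 11.1 being the tree theorem `exists_jtV_le`) and, since
`FriedlanderIwaniecPrimesJacobiTwistedProp131`, Proposition 13.1 from Proposition 12.1
(`jtV_prop131_of_prop121`). This file composes the two: **Proposition 14.1 follows from
Proposition 12.1 alone** (`jtV_prop141_of_prop121`), Proposition 12.1 ((12.3)–(12.4), §12, not yet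
in the tree) entering as the single hypothesis `h12`, quantified over all levels `D' ≥ 1`, with
the exponent `ε/2` and coefficients supported on `(r, 2s) = 1` as printed. No definitions, no named
facts.
-/

open Finset Real
open scoped Nat ArithmeticFunction.sigma

namespace Literature.NumberTheory.Sieve.FriedlanderIwaniecPrimes

/-- **Proposition 14.1 from Proposition 12.1** [FI, §14]: for every `0 < ε ≤ 1` and every
`C₁₂ ≥ 0` for which (12.3)–(12.4) hold at all levels `D' ≥ 1` (exponent `ε/2`, coefficients
supported on `(r, 2s) = 1`), there is `C₁₄ ≥ 0` such that for all `D, R, S ≥ 1` and all such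
`α_{rs}`:
`V(D) ≤ C₁₄ {D + D^{-1/2}RS + D^{1/3}(RS)^{2/3}(log 2RS)⁴ + (R+S)^{1/12}(RS)^{11/12}(RS)^ε} Σ τ(r)|α_{rs}|²`
— Proposition 11.1 from the tree, Proposition 13.1 by `jtV_prop131_of_prop121`, the three ranges by
`jtV_le_of_three_ranges`. [cite: FriedlanderIwaniecAnnals1998, Proposition 14.1] -/
theorem jtV_prop141_of_prop121 {ε : ℝ} (hε : 0 < ε) (hε1 : ε ≤ 1) {C₁₂ : ℝ} (hC₁₂ : 0 ≤ C₁₂)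
    (h12 : ∀ (D R S : ℕ) (α : ℕ → ℕ → ℂ), 1 ≤ D → 1 ≤ R → 1 ≤ S →
      (∀ r s, α r s ≠ 0 → r.Coprime (2 * s)) →
      jtV D (2 * D) R S α ≤ C₁₂ * ((D : ℝ) + (D : ℝ) ^ (1 / 3 : ℝ) * ((R : ℝ) * S) ^ (2 / 3 : ℝ) *
            Real.log (2 * R * S) ^ 4 +
          ((D : ℝ)⁻¹ * ((R : ℝ) * S) ^ (3 / 2 : ℝ) + R * (S : ℝ) ^ (3 / 4 : ℝ) + S * (R : ℝ) ^ (3 / 4 : ℝ)) *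
            ((R : ℝ) * S) ^ (ε / 2)) *
        ∑ r ∈ Ioc R (2 * R), ∑ s ∈ Ioc S (2 * S), (σ 0 r : ℝ) * ‖α r s‖ ^ 2) :
    ∃ C₁₄ : ℝ, 0 ≤ C₁₄ ∧ ∀ (D R S : ℕ) (α : ℕ → ℕ → ℂ), 1 ≤ D → 1 ≤ R → 1 ≤ S →
      (∀ r s, α r s ≠ 0 → r.Coprime (2 * s)) →
      jtV D (2 * D) R S α ≤ C₁₄ *
        ((D : ℝ) + (D : ℝ) ^ (-(1 / 2 : ℝ)) * ((R : ℝ) * S) +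
          (D : ℝ) ^ (1 / 3 : ℝ) * ((R : ℝ) * S) ^ (2 / 3 : ℝ) * Real.log (2 * R * S) ^ 4 +
          ((R : ℝ) + S) ^ (1 / 12 : ℝ) * ((R : ℝ) * S) ^ (11 / 12 : ℝ) * ((R : ℝ) * S) ^ ε) *
        ∑ r ∈ Ioc R (2 * R), ∑ s ∈ Ioc S (2 * S), (σ 0 r : ℝ) * ‖α r s‖ ^ 2 := by
  obtain ⟨C₁₁, hC₁₁, h3⟩ := jtV_le_of_three_ranges hε
  obtain ⟨C₁₃, hC₁₃, h13⟩ := jtV_prop131_of_prop121 hε hε1 hC₁₂ h12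
  refine ⟨4 * (C₁₁ + C₁₂ + C₁₃), by positivity, fun D R S α hD hR hS hα => ?_⟩
  have hRr : (1 : ℝ) ≤ R := by exact_mod_cast hR
  have hSr : (1 : ℝ) ≤ S := by exact_mod_cast hS
  have hRS1 : (1 : ℝ) ≤ (R : ℝ) * S := by nlinarith
  -- Proposition 12.1 at level `D`, exponent weakened from `ε/2` to `ε`
  have h12D := h12 D R S α hD hR hS hα
  have hhalf : ((R : ℝ) * S) ^ (ε / 2) ≤ ((R : ℝ) * S) ^ ε :=
    Real.rpow_le_rpow_of_exponent_le hRS1 (by linarith)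
  have hNτ0 : 0 ≤ ∑ r ∈ Ioc R (2 * R), ∑ s ∈ Ioc S (2 * S), (σ 0 r : ℝ) * ‖α r s‖ ^ 2 := by positivity
  have h12D' : jtV D (2 * D) R S α ≤ C₁₂ * ((D : ℝ) + (D : ℝ) ^ (1 / 3 : ℝ) * ((R : ℝ) * S) ^ (2 / 3 : ℝ) *
        Real.log (2 * R * S) ^ 4 +
      ((D : ℝ)⁻¹ * ((R : ℝ) * S) ^ (3 / 2 : ℝ) + R * (S : ℝ) ^ (3 / 4 : ℝ) + S * (R : ℝ) ^ (3 / 4 : ℝ)) *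
        ((R : ℝ) * S) ^ ε) *
      ∑ r ∈ Ioc R (2 * R), ∑ s ∈ Ioc S (2 * S), (σ 0 r : ℝ) * ‖α r s‖ ^ 2 := by
    refine h12D.trans (mul_le_mul_of_nonneg_right (mul_le_mul_of_nonneg_left ?_ hC₁₂) hNτ0)
    have hB : 0 ≤ (D : ℝ)⁻¹ * ((R : ℝ) * S) ^ (3 / 2 : ℝ) + R * (S : ℝ) ^ (3 / 4 : ℝ) +
        S * (R : ℝ) ^ (3 / 4 : ℝ) := by positivity
    have := mul_le_mul_of_nonneg_left hhalf hB
    linarith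
  have h13D := h13 D R S α hD hR hS hα
  exact h3 D R S α C₁₂ C₁₃ hD hR hS hC₁₂ hC₁₃ h12D' h13D

end Literature.NumberTheory.Sieve.FriedlanderIwaniecPrimes
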